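import Literature.Probability.RandomPlanarGeometry.RadialBesselCocycle
import Literature.Probability.Process.LevyCharacterisation
import HarnessLib

/-!
# The maximal radial Bessel flow: joint measurability in time, starting point and sample

Topic `Probability/RandomPlanarGeometry`; theorems only, sequel of `RadialBesselExit` /
`RadialBesselCocycle`. The maximal radial Bessel flow `Y = arg U hc θ : ℝ≥0 → Ω → ℝ` of a family
of continuous driving paths `U` (Lawler (2005), (1.16), (6.12); LSW (2002), (2.9)–(2.11);
`RadialBesselExit.arg`) is assembled from the level flows below the lifetime `T` and carries the
junk value `0` from `T` on. We record its measurability, needed to speak of the *laws*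
`P[Yₜ^θ ∈ ·]` as a Markov kernel in `θ` (and jointly in `(t, θ)`), and of `Y_s` as an
`𝓕_s`-measurable frozen datum in the Markov property:

* `arg_of_not_lt_lifetime` — from the lifetime on (`t ≠ 0`) the flow is the junk value `0`;
  `eventually_arg_min_exitLevel_eq` — before the lifetime it is eventually (in the level `n`) the
  flow stopped at `σₙ`, read at time `t`;
* `measurable_arg_uncurry₃` — `(t, θ, ω) ↦ Yₜ^θ(ω)` is jointly measurable (paths measurable at
  each time), whence `measurable_arg_prod` (`(θ, ω) ↦ Yₜ^θ(ω)`), `measurable_arg` (`ω ↦ Yₜ^θ(ω)`),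
  `measurable_arg_time` (`(t, ω) ↦ Yₜ^θ(ω)`);
* `measurable_arg_filtration` — `ω ↦ Yₜ^θ(ω)` is `𝓕_t`-measurable for any filtration to which the
  driving path is adapted.

The proofs read `Y` as the pointwise limit of the jointly measurable stopped level flows on
`{t < T}` (junk elsewhere) and use `measurable_of_tendsto_metrizable`.

## References

* G. F. Lawler, *Conformally Invariant Processes in the Plane*, AMS (2005), §1.11, §6.4 (6.12).
  [Lawler2005]
* G. F. Lawler, O. Schramm, W. Werner, *One-arm exponent for critical 2D percolation*, Electron.
  J. Probab. 7 (2002), no. 2, §2 (2.9)–(2.11). [LawlerSchrammWernerEJP2002]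
-/

noncomputable section

open MeasureTheory ProbabilityTheory Filter Topology Set

namespace Literature.Probability.RandomPlanarGeometry

namespace RadialLoewner

open Literature.Probability.Process
open scoped NNReal

variable {Ω : Type*} {mΩ : MeasurableSpace Ω} {U : Ω → ℝ≥0 → ℝ}

/-! ### The flow off and on `{t < T}` -/

/-- A start inside some level interval is in `(0, 2π)`. [folklore] -/
theorem mem_Ioo_of_mem_Ioo_level {n : ℕ} {θ : ℝ}
    (h : θ ∈ Ioo (2 * level n) (2 * Real.pi - 2 * level n)) : θ ∈ Ioo 0 (2 * Real.pi) := by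
  have := level_pos n
  exact ⟨by linarith [h.1], by linarith [h.2]⟩

variable (hc : ∀ ω, Continuous (U ω))

/-- **From the lifetime on, the flow is the junk value `0`** (times `t ≠ 0`; at `t = 0` the flow
is the start `θ`, also when `T = 0`, i.e. `θ ∉ (0, 2π)`). [folklore] -/
theorem arg_of_not_lt_lifetime {θ : ℝ} {ω : Ω} {t : ℝ≥0}
    (ht : ¬ (t : WithTop ℝ≥0) < lifetime U hc θ ω) (ht0 : t ≠ 0) : arg U hc θ t ω = 0 := by
  classical
  have hno : ¬ ∃ n : ℕ, (t : WithTop ℝ≥0) ≤ exitLevel U hc n θ ω := by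
    rintro ⟨n, hn⟩
    by_cases hθn : θ ∈ Ioo (2 * level n) (2 * Real.pi - 2 * level n)
    · have hθ := mem_Ioo_of_mem_Ioo_level hθn
      by_cases hT : lifetime U hc θ ω = ⊤
      · exact ht (by rw [hT]; exact WithTop.coe_lt_top t)
      · exact ht (hn.trans_lt (exitLevel_lt_lifetime hc hθ (lt_top_iff_ne_top.2 hT) n))
    · rw [exitLevel_eq_zero_of_not_mem hc hθn ω, nonpos_iff_eq_zero, WithTop.coe_eq_zero] at hn
      exact ht0 hn
  rw [arg, dif_neg hno]

/-- **Before the lifetime, the flow at time `t` is eventually the flow stopped at `σₙ` read at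
`t`** (for all large levels `n`, `t < σₙ`). [folklore] -/
theorem eventually_arg_min_exitLevel_eq {θ : ℝ} {ω : Ω} {t : ℝ≥0}
    (ht : (t : WithTop ℝ≥0) < lifetime U hc θ ω) :
    ∀ᶠ n in atTop, arg U hc θ (min (t : WithTop ℝ≥0) (exitLevel U hc n θ ω)).untopA ω =
      arg U hc θ t ω := by
  obtain ⟨N, hN⟩ := eventually_lt_exitLevel hc ht
  filter_upwards [eventually_ge_atTop N] with n hn
  rw [untopA_min_of_le (hN n hn).le]

/-! ### Joint measurability -/

/-- The stopped level flows are jointly measurable in `(t, θ, ω)` (continuous in `t`, jointly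
measurable in `(θ, ω)` at each time). [folklore] -/
theorem measurable_stoppedProcess_argLevel_uncurry₃ (hmeas : ∀ s, Measurable fun ω ↦ U ω s) (n : ℕ) :
    Measurable fun q : ℝ≥0 × (ℝ × Ω) ↦
      stoppedProcess (argLevel U hc n q.2.1) (exitLevel U hc n q.2.1) q.1 q.2.2 :=
  measurable_uncurry_of_continuous_of_measurable
    (u := fun (t : ℝ≥0) (p : ℝ × Ω) ↦ stoppedProcess (argLevel U hc n p.1) (exitLevel U hc n p.1) t p.2)
    (fun p ↦ continuous_stoppedProcess_path
      (continuous_argTrunc hc (level_pos n) (level_le n) p.1 p.2) _)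
    (fun t ↦ measurable_stoppedProcess_argLevel_prod hc hmeas n t)

/-- The junk-completed limit values off `{t < T}`: the start at time `0`, else `0`. [folklore] -/
theorem arg_eq_ite_of_not_lt_lifetime {θ : ℝ} {ω : Ω} {t : ℝ≥0}
    (ht : ¬ (t : WithTop ℝ≥0) < lifetime U hc θ ω) :
    arg U hc θ t ω = if t = 0 then θ else 0 := by
  by_cases h0 : t = 0
  · rw [if_pos h0, h0, arg_zero]
  · rw [if_neg h0, arg_of_not_lt_lifetime hc ht h0]

/-- The stopped level flow read at `t` is the maximal flow at the capped time `t ∧ σₙ`.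
[folklore] -/
theorem stoppedProcess_argLevel_eq_arg (n : ℕ) (θ : ℝ) (t : ℝ≥0) (ω : Ω) :
    stoppedProcess (argLevel U hc n θ) (exitLevel U hc n θ) t ω =
      arg U hc θ (min (t : WithTop ℝ≥0) (exitLevel U hc n θ ω)).untopA ω := by
  rw [stoppedProcess, arg_eq_argLevel hc (coe_untopA_min_le _ _)]

/-- **The maximal flow is jointly measurable in `(t, θ, ω)`.** [folklore] -/
theorem measurable_arg_uncurry₃ (hmeas : ∀ s, Measurable fun ω ↦ U ω s) :
    Measurable fun q : ℝ≥0 × (ℝ × Ω) ↦ arg U hc q.2.1 q.1 q.2.2 := by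
  classical
  -- the event `{t < T}` and the junk-completed limit values elsewhere
  set A : Set (ℝ≥0 × (ℝ × Ω)) := {q | (q.1 : WithTop ℝ≥0) < lifetime U hc q.2.1 q.2.2} with hA
  have hAm : MeasurableSet A :=
    measurableSet_lt measurable_fst.withTop_coe ((measurable_lifetime_prod hc hmeas).comp measurable_snd)
  set g : ℝ≥0 × (ℝ × Ω) → ℝ := fun q ↦ if q.1 = 0 then q.2.1 else 0 with hg
  have hgm : Measurable g :=
    Measurable.ite (measurableSet_eq_fun measurable_fst measurable_const) measurable_snd.fst
      measurable_const
  -- the approximants: stopped level flows on `{t < T}`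
  set f : ℕ → ℝ≥0 × (ℝ × Ω) → ℝ := fun n q ↦ if q ∈ A then
    stoppedProcess (argLevel U hc n q.2.1) (exitLevel U hc n q.2.1) q.1 q.2.2 else g q with hf
  have hfm : ∀ n, Measurable (f n) := fun n ↦
    Measurable.ite hAm (measurable_stoppedProcess_argLevel_uncurry₃ hc hmeas n) hgm
  refine measurable_of_tendsto_metrizable hfm (tendsto_pi_nhds.2 fun q ↦ ?_)
  by_cases hq : q ∈ A
  · have hev := eventually_arg_min_exitLevel_eq hc (θ := q.2.1) (ω := q.2.2) (t := q.1) hq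
    refine (tendsto_const_nhds (x := arg U hc q.2.1 q.1 q.2.2)).congr' ?_
    filter_upwards [hev] with n hn
    simp only [hf, if_pos hq]
    rw [stoppedProcess_argLevel_eq_arg hc, hn]
  · have hval : arg U hc q.2.1 q.1 q.2.2 = g q := arg_eq_ite_of_not_lt_lifetime hc hq
    simp only [hf, if_neg hq, hval]
    exact tendsto_const_nhds

/-- **The maximal flow at time `t` is jointly measurable in `(θ, ω)`.** [folklore] -/
theorem measurable_arg_prod (hmeas : ∀ s, Measurable fun ω ↦ U ω s) (t : ℝ≥0) :
    Measurable fun p : ℝ × Ω ↦ arg U hc p.1 t p.2 :=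
  Measurable.comp (g := fun q : ℝ≥0 × (ℝ × Ω) ↦ arg U hc q.2.1 q.1 q.2.2) (f := fun p : ℝ × Ω ↦ (t, p))
    (measurable_arg_uncurry₃ hc hmeas) (measurable_const.prodMk measurable_id)

/-- The maximal flow at time `t` from `θ` is measurable in `ω`. [folklore] -/
theorem measurable_arg (hmeas : ∀ s, Measurable fun ω ↦ U ω s) (θ : ℝ) (t : ℝ≥0) :
    Measurable fun ω ↦ arg U hc θ t ω :=
  Measurable.comp (g := fun p : ℝ × Ω ↦ arg U hc p.1 t p.2) (f := fun ω : Ω ↦ (θ, ω))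
    (measurable_arg_prod hc hmeas t) (measurable_const.prodMk measurable_id)

/-- The maximal flow from `θ` is jointly measurable in `(t, ω)`. [folklore] -/
theorem measurable_arg_time (hmeas : ∀ s, Measurable fun ω ↦ U ω s) (θ : ℝ) :
    Measurable fun q : ℝ≥0 × Ω ↦ arg U hc θ q.1 q.2 :=
  Measurable.comp (g := fun q : ℝ≥0 × (ℝ × Ω) ↦ arg U hc q.2.1 q.1 q.2.2)
    (f := fun q : ℝ≥0 × Ω ↦ (q.1, (θ, q.2)))
    (measurable_arg_uncurry₃ hc hmeas) (measurable_fst.prodMk (measurable_const.prodMk measurable_snd))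

/-- **The maximal flow at time `t` is `𝓕_t`-measurable** for every filtration `𝓕` to which the
driving path is adapted (raw filtrations included). [folklore] -/
theorem measurable_arg_filtration {𝓕 : Filtration ℝ≥0 mΩ}
    (hU : ∀ s, Measurable[𝓕 s] fun ω ↦ U ω s) (θ : ℝ) (t : ℝ≥0) :
    Measurable[𝓕 t] fun ω ↦ arg U hc θ t ω := by
  classical
  set A : Set Ω := {ω | (t : WithTop ℝ≥0) < lifetime U hc θ ω} with hA
  have hAm : MeasurableSet[𝓕 t] A := by
    have h : A = {ω | lifetime U hc θ ω ≤ (t : WithTop ℝ≥0)}ᶜ := by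
      ext ω; simp [hA]
    rw [h]
    exact ((isStoppingTime_lifetime hc hU θ) t).compl
  set c : ℝ := if t = 0 then θ else 0 with hcdef
  set f : ℕ → Ω → ℝ := fun n ω ↦ if ω ∈ A then
    stoppedProcess (argLevel U hc n θ) (exitLevel U hc n θ) t ω else c with hf
  have hfm : ∀ n, Measurable[𝓕 t] (f n) := fun n ↦
    Measurable.ite hAm
      (Process.stronglyAdapted_stoppedProcess_exitTime
        (adapted_argTrunc hc (level_pos n) (level_le n) hU θ)
        (continuous_argTrunc hc (level_pos n) (level_le n) θ) t).measurable
      (@measurable_const _ _ _ (𝓕 t) c)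
  refine @measurable_of_tendsto_metrizable Ω ℝ (𝓕 t) _ _ _ _ f _ hfm (tendsto_pi_nhds.2 fun ω ↦ ?_)
  by_cases hω : ω ∈ A
  · have hev := eventually_arg_min_exitLevel_eq hc (θ := θ) (ω := ω) (t := t) hω
    refine (tendsto_const_nhds (x := arg U hc θ t ω)).congr' ?_
    filter_upwards [hev] with n hn
    simp only [hf, if_pos hω]
    rw [stoppedProcess_argLevel_eq_arg hc, hn]
  · have hval : arg U hc θ t ω = c := arg_eq_ite_of_not_lt_lifetime hc hω
    simp only [hf, if_neg hω, hval]
    exact tendsto_const_nhds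

end RadialLoewner

end Literature.Probability.RandomPlanarGeometry
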